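import Summits.HodgeConjecture.HodgeConjecture.Theorems.CurveNetMordellWeilVerticalSupportFourfoldsStubTransferConverse
import Summits.HodgeConjecture.HodgeConjecture.Theorems.CurveNetMordellWeilVerticalSupportFourfoldsStubDetectionTransfer
import Literature.AlgebraicGeometry.HodgeTheory.HardLefschetzHodgeRiemannHolds
import Literature.AlgebraicGeometry.HodgeTheory.SaitoGrFDeRhamCurveNetHolds
import Literature.AlgebraicTopology.SingularHomology.GysinTransposition
import HarnessLib

/-!
# Route CurveNetMordellWeil · crux `VerticalSupportFourfolds` (stmt-HodgeConjecture-2784) — line `Sketch`: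
# the literature-debt stub `stub_facts`, and the UNCONDITIONAL equivalence crux ⇔ vertical detection

The registered skeleton `Cruxes/VerticalSupportFourfolds/Lines/Sketch.lean` of the line `Sketch`
(idea card `vertical-detection-contact-locus`) has the stubs `stub_facts` (literature debt: the perfect
pairing on Hodge classes of smooth projective THREEFOLDS, Brosnan–Fang–Nie–Pearlstein 2009 §6 (6.1)),
`stub_verticalDetection` (C⁺, the open heart), `stub_transferConverse` (landed, p106042) and
`stub_detectionTransfer` (landed, p104480); its composition is
`VerticalSupportFourfolds_of = stub_detectionTransfer (threefoldPairing_of_facts stub_facts) topGysin stub_verticalDetection`.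

Since the skeleton was registered the tree PROVED the Kähler package of the hyperplane class
(`hardLefschetz_hodgeRiemann_holds`, file `HardLefschetzHodgeRiemannHolds`), whose consequence
`hardLefschetz_hodgeRiemann.hodgeClasses_cupPairing_nondegenerate` is BFNP (6.1) in every degree, and
Deligne's Hodge III Cor. 8.2.8 (`Deligne1974_ker_restrictCompl_eq_iSup_range_complexGysin_holds`).
Hence:

* `VerticalSupportFourfolds.stub_facts` — the registered stub, VERBATIM, now a one-liner;
* `verticalSupportFourfolds_iff_verticalDetection` — the line's documented equivalence
  "crux ⇔ C⁺ modulo catalogued classical facts" with ALL three facts discharged: the crux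
  `VerticalSupportFourfolds` is unconditionally EQUIVALENT to vertical detection;
* `verticalSupportFourfolds_of_verticalDetection` — the crux BY NAME from the one remaining stub
  `stub_verticalDetection` alone (the line is now exactly its open heart).

No new mathematics: bookkeeping over landed theorems (`Theorems.stub_transferConverse`,
`Theorems.stub_detectionTransfer`) and the two discharged Literature facts; top-degree injectivity of
Gysin morphisms is re-derived (`topGysin_injective_of_hasPoincareDuality`, Fulton App. B §B.1 (5)).
-/

noncomputable section

set_option linter.dupNamespace false

open CategoryTheory AlgebraicGeometry
open Literature.AlgebraicGeometry Literature.AlgebraicGeometry.Motives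
  Literature.AlgebraicGeometry.HodgeTheory Literature.AlgebraicTopology.SingularHomology
open Summit.HodgeConjecture.HodgeConjecture.Theses.CurveNetMordellWeil (VerticalSupportFourfolds)

namespace Summit.HodgeConjecture.HodgeConjecture.Theorems

namespace VerticalSupportFourfolds

/-- **Registered stub `stub_facts` of line `Sketch` (crux `VerticalSupportFourfolds`,
stmt-HodgeConjecture-2784), DISCHARGED**: the perfect pairing on Hodge classes
`hodgeClasses_cupPairing_nondegenerate 3 W` for every `W` (the statement is guarded by
`IsSmoothProjective 3 W` inside the fact) — Brosnan–Fang–Nie–Pearlstein 2009 §6 (6.1), obtained from the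
tree's PROVED Kähler package `hardLefschetz_hodgeRiemann_holds` (Voisin I Thm. 6.25 / 6.32, §7.1.2)
through `hardLefschetz_hodgeRiemann.hodgeClasses_cupPairing_nondegenerate`.
[cite: BrosnanFangNiePearlstein2009, §6 (6.1)] [cite: VoisinHodgeI2002, Thm. 6.25 and Thm. 6.32] -/
theorem stub_facts : ∀ W : SchemeOver ℂ, hodgeClasses_cupPairing_nondegenerate 3 W :=
  fun _ ↦ hardLefschetz_hodgeRiemann_holds.hodgeClasses_cupPairing_nondegenerate

end VerticalSupportFourfolds

/-- **BFNP (6.1) in every dimension, unconditionally**: the cup product is a perfect pairing on the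
rational Hodge classes of every smooth projective `d`-fold, `hodgeClasses_cupPairing_nondegenerate d X`,
from the proved Kähler package `hardLefschetz_hodgeRiemann_holds`.
[cite: BrosnanFangNiePearlstein2009, §6 (6.1)] [cite: VoisinHodgeI2002, Thm. 6.32] -/
theorem hodgeClasses_cupPairing_nondegenerate_all (d : ℕ) (X : SchemeOver ℂ) :
    hodgeClasses_cupPairing_nondegenerate d X :=
  hardLefschetz_hodgeRiemann_holds.hodgeClasses_cupPairing_nondegenerate

/-- **Top-degree Gysin push-forwards are injective** (Fulton, Intersection Theory App. B / Young
Tableaux App. B §B.1 (5)): for `g : W ⟶ X` between smooth projective varieties of dimensions `m`, `n`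
and an orientation family with Poincaré duality, `g_* : H^{2m}(W(ℂ); ℂ) → H^{2n}(X(ℂ); ℂ)` is injective —
it is the Gysin homomorphism through `H₀` (`complexGysin_eq_gysinMap`), which preserves the evaluation
on fundamental classes (`kroneckerPairing_gysinMap_fundamentalClass`), and `⟨-, [W(ℂ)]⟩` is injective on
the top line (`H_{2m}(W(ℂ); ℂ) = ℂ·[W(ℂ)]`, Kronecker injectivity over a field). Same proof as the
skeleton's `topGysin_injective`. [cite: FultonYoungTableaux1997, Appendix B §B.1 (5)]
[cite: HatcherAT2002, Thm. 3.26] -/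
theorem topGysin_injective_of_hasPoincareDuality (μ : OrientationFamily) (hμ : μ.HasPoincareDuality)
    {m n : ℕ} {W X : Motives.SchemeOver ℂ} (hW : Motives.IsSmoothProjective m W)
    (hX : Motives.IsSmoothProjective n X) (g : W ⟶ X) {a b : ℕ} (hab : a + 2 * n = b + 2 * m)
    (ha : a = 2 * m) : Function.Injective (complexGysin μ hW hX g hab) := by
  -- adapted from Cruxes/VerticalSupportFourfolds/Lines/Sketch.lean `topGysin_injective`
  subst ha
  obtain rfl : b = 2 * n := by omega
  rw [complexGysin_eq_gysinMap hW hX g hab (q := 0) (Nat.add_zero _) (Nat.add_zero _)]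
  refine (injective_iff_map_eq_zero _).2 fun z hz ↦ ?_
  letI := hW.chartedSpace
  haveI := ComplexPoints.compactSpace_of_isSmoothProjective hW
  haveI := ComplexPoints.t2Space_of_isSmoothProjective hW
  haveI := connectedSpace_complexPoints hW
  have h := kroneckerPairing_gysinMap_fundamentalClass (μY := μ hW) (hμ hX)
    (AlgPoints.mapContinuous (L := ℂ) g) (Nat.add_zero _) (Nat.add_zero _) z
  rw [hz, map_zero, LinearMap.zero_apply] at h
  apply kroneckerPairing_injective_of_field ℂ (ComplexPoints W) (2 * m)
  rw [map_zero]
  refine LinearMap.ext fun w ↦ ?_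
  obtain ⟨r, rfl⟩ := exists_eq_smul_fundamentalClass_of_connectedSpace (μ hW) w
  rw [map_smul, ← h, smul_zero, LinearMap.zero_apply]

/-- **The threefold pairing slice `(k, l) = (2, 1)` of BFNP (6.1), unconditionally** (the card's
`ThreefoldDivisorDetection`, the skeleton's `threefoldPairing_of_facts stub_facts`): a non-zero rational
`(2,2)`-class on a smooth projective threefold cups non-trivially with some rational `(1,1)`-class.
[cite: BrosnanFangNiePearlstein2009, §6 (6.1)] -/
theorem threefoldPairing_holds :
    ∀ ⦃W : Motives.SchemeOver ℂ⦄, Motives.IsSmoothProjective 3 W →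
      ∀ (m : ℕ) (hm : 2 * 2 + 2 * 1 = m) (c : complexBetti W (2 * 2)), IsRationalClass c →
        IsOfHodgeType 3 W (2 * 2) 2 2 c → c ≠ 0 →
          ∃ a : complexBetti W (2 * 1), IsRationalClass a ∧ IsOfHodgeType 3 W (2 * 1) 1 1 a ∧
            cupProduct hm c a ≠ 0 :=
  fun W hW m hm c hc hH hne ↦ VerticalSupportFourfolds.stub_facts W hW m (by norm_num) hm c hc hH hne

/-- **Crux ⇔ C⁺, UNCONDITIONALLY** (line `Sketch`, card `vertical-detection-contact-locus`): the crux
`VerticalSupportFourfolds` (stmt-HodgeConjecture-2784) is EQUIVALENT to VERTICAL DETECTION — on a smooth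
projective fourfold `X` with a surjection `pr : X ⟶ ℙ³`, a rational `(2,2)`-class which pulls back to
zero along every vertical smooth projective threefold `g : W ⟶ X` (`pr ∘ g` lands in a proper
Zariski-closed subset of `ℙ³`) is zero. Forward: the landed `Theorems.stub_transferConverse` (p106042)
fed with Deligne's Hodge III Cor. 8.2.8 (`Deligne1974_ker_restrictCompl_eq_iSup_range_complexGysin_holds`)
and BFNP (6.1) on fourfolds; backward: the landed `Theorems.stub_detectionTransfer` (p104480) fed with
BFNP (6.1) on threefolds (`threefoldPairing_holds`) and top-degree injectivity of Gysin morphisms.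
The skeleton stated this equivalence modulo the three named facts
(`verticalSupportFourfolds_iff_verticalDetection (hA) (hP4) (hP3)`); all three are now theorems.
[cite: BrosnanFangNiePearlstein2009, §6 (6.1)] [cite: DeligneHodgeIII1974, Cor. 8.2.8] -/
theorem verticalSupportFourfolds_iff_verticalDetection :
    VerticalSupportFourfolds ↔
    ∀ ⦃X : Motives.SchemeOver ℂ⦄ (pr : X ⟶ Motives.projectiveSpace 3 ℂ),
      Motives.IsSmoothProjective 4 X → Function.Surjective pr.left.base →
        ∀ c : complexBetti X (2 * 2), IsRationalClass c → IsOfHodgeType 4 X (2 * 2) 2 2 c →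
          (∀ ⦃W : Motives.SchemeOver ℂ⦄, Motives.IsSmoothProjective 3 W → ∀ g : W ⟶ X,
              (∃ T : Set (Motives.projectiveSpace 3 ℂ).left, IsClosed T ∧ T ≠ Set.univ ∧
                  Set.range (g ≫ pr).left.base ⊆ T) →
                complexBetti.map g (2 * 2) c = 0) →
            c = 0 :=
  ⟨stub_transferConverse Deligne1974_ker_restrictCompl_eq_iSup_range_complexGysin_holds
      (hodgeClasses_cupPairing_nondegenerate_all 4),
    fun hDet _ pr hX hsurj ↦
      (stub_detectionTransfer threefoldPairing_holds
        (fun μ hμ _ _ _ _ hW hX g _ _ hab ha ↦ topGysin_injective_of_hasPoincareDuality μ hμ hW hX g hab ha)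
        hDet pr hX hsurj).trans le_sup_right⟩

/-- **The crux BY NAME from the one remaining stub** (the composition `VerticalSupportFourfolds_of` of
the registered skeleton with `stub_facts`, `stub_detectionTransfer` and top-degree Gysin injectivity
discharged): vertical detection (`stub_verticalDetection`, C⁺) implies `VerticalSupportFourfolds`.
[cite: BrosnanFangNiePearlstein2009, §6 (6.1)] -/
theorem verticalSupportFourfolds_of_verticalDetection
    (hDet : ∀ ⦃X : Motives.SchemeOver ℂ⦄ (pr : X ⟶ Motives.projectiveSpace 3 ℂ),
      Motives.IsSmoothProjective 4 X → Function.Surjective pr.left.base →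
        ∀ c : complexBetti X (2 * 2), IsRationalClass c → IsOfHodgeType 4 X (2 * 2) 2 2 c →
          (∀ ⦃W : Motives.SchemeOver ℂ⦄, Motives.IsSmoothProjective 3 W → ∀ g : W ⟶ X,
              (∃ T : Set (Motives.projectiveSpace 3 ℂ).left, IsClosed T ∧ T ≠ Set.univ ∧
                  Set.range (g ≫ pr).left.base ⊆ T) →
                complexBetti.map g (2 * 2) c = 0) →
            c = 0) :
    VerticalSupportFourfolds :=
  verticalSupportFourfolds_iff_verticalDetection.2 hDet

end Summit.HodgeConjecture.HodgeConjecture.Theorems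

end
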